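import Literature.NumberTheory.EllipticCurves.KernelReductionDivisibleProofs
import Literature.NumberTheory.EllipticCurves.TorsionCardinality
import Mathlib.RingTheory.Polynomial.Vieta
import HarnessLib

/-!
# The kernel of reduction is `3`-divisible at a place of residue characteristic `3` where `b₂` is a unit (height one:
# multiplicative reduction at `3`, or good ordinary at `3`), over an algebraically closed valued field (theorems only; no definition,
# no named fact, no instance, no `sorry`)

Companion of `KernelReductionDivisibleProofs` (`exists_zsmul_eq_of_one_lt_val`: `E₁(L)` is `m`-divisible for `|m| = 1`, Silverman
AEC IV.3.2(b)/VII.2.2 by division polynomials).  Here the case `m = 3 =` residue characteristic, under the HEIGHT-ONE hypothesis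
`|b₂| = 1` (`c₄ = b₂² − 24 b₄ ≡ b₂² (mod 3)`, so at residue characteristic `3` this is «`c₄` a unit»: multiplicative OR good ordinary
reduction), which is what the twin `E′` of crux stmt-BirchSwinnertonDyer-24737 (`3 ∥ N′`) needs at the places above `3` (cell x9's
`exists_nsmul_eq_of_mem_localKernelOfReduction`, the divisibility input of the H.4/H.5(b) assemblies at `v ∣ p`, was available only at
GOOD ordinary places):

* `val_coeff_six_ΨSq_three` — `ΨSq₃ = Ψ₃²` has `X⁶`-coefficient `b₂² + 18 b₄`, a unit when `|b₂| = 1 > |3|`;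
* `exists_root_one_lt_val_of_monic` — a monic polynomial over an algebraically closed valued field with SOME coefficient of valuation
  `> 1` has a root of valuation `> 1` (Vieta: if all roots are integral so are all coefficients);
* **`exists_zsmul_three_eq_of_one_lt_val`** — for `P = (x, y) ∈ E₁(L)` (`|x| > 1`) there is `Q = (x', y') ∈ E₁(L)` with `3 • Q = P`:
  the polynomial `F = Φ₃ − x·ΨSq₃` (roots = abscissae of the nine `Q` with `3Q = ±P`, AEC Ex. 3.7(d)) is monic of degree `9` with
  `|F₆| = |x| > 1`, so it has a root `x'` with `|x'| > 1`; `ΨSq₃(x') ≠ 0` (else `Φ₃(x') = 0`, contradicting `(Φ₃, ΨSq₃) = 1`, tree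
  `eval_Φ_ne_zero_of_eval_ΨSq_eq_zero`), hence `x(3Q) = x` and `3Q = ±P`.
For the Tate curve this is the `3`-divisibility of `1 + 𝔪 ⊂ K̄ˣ/q^ℤ`; no uniformisation is used.

References: J. H. Silverman, AEC (2009), Prop. IV.3.2(b), VII.2.2, Ex. 3.7(d) [SilvermanAEC2009]; R. Greenberg, LNM 1716 (1999), §2 p. 82
(«𝓕(𝔪̄) is divisible») [GreenbergLNM1716].  BSD is not proved by any of this.
-/

noncomputable section

open scoped Classical NNReal
open Polynomial WeierstrassCurve

universe u

namespace Literature.NumberTheory.EllipticCurves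

variable {L : Type u} [Field L] {w : Valuation L ℝ≥0}

/-! ## §1 Valuation bookkeeping -/

/-- A multiset of elements of valuation `≤ 1` has product of valuation `≤ 1`. [folklore] -/
private theorem val_multiset_prod_le_one (t : Multiset L) (ht : ∀ a ∈ t, w a ≤ 1) : w t.prod ≤ 1 := by
  induction t using Multiset.induction_on with
  | empty => rw [Multiset.prod_zero, map_one]
  | cons a t ih =>
    rw [Multiset.prod_cons, map_mul]
    have ha : w a ≤ 1 := ht a (Multiset.mem_cons_self a t)
    have h' : w t.prod ≤ 1 := ih fun b hb ↦ ht b (Multiset.mem_cons_of_mem hb)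
    calc w a * w t.prod ≤ 1 * 1 := mul_le_mul' ha h'
      _ = 1 := one_mul 1

/-- A multiset of elements of valuation `≤ 1` has sum of valuation `≤ 1`. [folklore] -/
private theorem val_multiset_sum_le_one (t : Multiset L) (ht : ∀ a ∈ t, w a ≤ 1) : w t.sum ≤ 1 := by
  induction t using Multiset.induction_on with
  | empty => rw [Multiset.sum_zero, map_zero]; exact zero_le_one
  | cons a t ih =>
    rw [Multiset.sum_cons]
    exact (w.map_add _ _).trans (max_le (ht a (Multiset.mem_cons_self a t))
      (ih fun b hb ↦ ht b (Multiset.mem_cons_of_mem hb)))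

/-- Elementary symmetric functions of integral elements are integral. [folklore] -/
private theorem val_esymm_le_one (s : Multiset L) (hs : ∀ a ∈ s, w a ≤ 1) (j : ℕ) : w (s.esymm j) ≤ 1 := by
  rw [Multiset.esymm]
  refine val_multiset_sum_le_one _ fun b hb ↦ ?_
  obtain ⟨t, ht, rfl⟩ := Multiset.mem_map.mp hb
  have hts : t ≤ s := (Multiset.mem_powersetCard.mp ht).1
  exact val_multiset_prod_le_one t fun a ha ↦ hs a (Multiset.mem_of_le hts ha)

/-- **A monic polynomial with a coefficient of valuation `> 1` has a root of valuation `> 1`** (over an algebraically closed valued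
field): otherwise all roots are integral and, by Vieta, so are all coefficients (the elementary half of the Newton polygon; Cassels,
*Local Fields*, Ch. 6 §3; here needed for AEC IV.3.2(b) at `m = p`). [cite: SilvermanAEC2009, Prop. IV.3.2(b) (first proof, PDF p. 116)] -/
theorem exists_root_one_lt_val_of_monic [IsAlgClosed L] {F : L[X]} (hF : F.Monic) {i : ℕ} (hi : i ≤ F.natDegree)
    (hFi : 1 < w (F.coeff i)) : ∃ a : L, F.IsRoot a ∧ 1 < w a := by
  by_contra hno
  push Not at hno
  have hsplit : F.Splits := IsAlgClosed.splits F
  have hroots : ∀ a ∈ F.roots, w a ≤ 1 := fun a ha ↦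
    hno a ((mem_roots hF.ne_zero).mp ha)
  have hvieta := Polynomial.coeff_eq_esymm_roots_of_splits hsplit hi
  rw [hF.leadingCoeff, one_mul] at hvieta
  have hle : w (F.coeff i) ≤ 1 := by
    rw [hvieta, map_mul, map_pow, w.map_neg, map_one, one_pow, one_mul]
    exact val_esymm_le_one _ hroots _
  exact absurd hFi (not_lt.mpr hle)

/-! ## §2 The `X⁶`-coefficient of `ΨSq₃` -/

/-- `Ψ₃ = C 3 X⁴ + C b₂ X³ + C (3b₄) X² + C (3b₆) X + C b₈` with the numerals pushed into `C`. [cite: SilvermanAEC2009, III Ex. 3.7] -/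
private theorem Ψ₃_eq {R : Type u} [CommRing R] (V : WeierstrassCurve R) :
    V.Ψ₃ = C 3 * X ^ 4 + C V.b₂ * X ^ 3 + C (3 * V.b₄) * X ^ 2 + C (3 * V.b₆) * X + C V.b₈ := by
  rw [Ψ₃, map_mul, map_mul, map_ofNat]

/-- **The `X⁶`-coefficient of `ΨSq₃ = Ψ₃²` is `b₂² + 18 b₄`.** [cite: SilvermanAEC2009, III Ex. 3.7] -/
theorem coeff_six_ΨSq_three {R : Type u} [CommRing R] (V : WeierstrassCurve R) : (V.ΨSq 3).coeff 6 = V.b₂ ^ 2 + 18 * V.b₄ := by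
  have hsq : V.ΨSq 3 = V.Ψ₃ ^ 2 := by
    rw [show (3 : ℤ) = ((3 : ℕ) : ℤ) by rfl, ΨSq_ofNat, preΨ'_three, if_neg (by decide), mul_one]
  have hexp : V.Ψ₃ ^ 2 = C 9 * X ^ 8 + C (6 * V.b₂) * X ^ 7 + C (V.b₂ ^ 2 + 18 * V.b₄) * X ^ 6 +
      C (18 * V.b₆ + 6 * V.b₂ * V.b₄) * X ^ 5 + C (6 * V.b₈ + 6 * V.b₂ * V.b₆ + 9 * V.b₄ ^ 2) * X ^ 4 +
      C (2 * V.b₂ * V.b₈ + 18 * V.b₄ * V.b₆) * X ^ 3 + C (6 * V.b₄ * V.b₈ + 9 * V.b₆ ^ 2) * X ^ 2 +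
      C (6 * V.b₆ * V.b₈) * X + C (V.b₈ ^ 2) := by
    rw [Ψ₃_eq]
    simp only [map_add, map_mul, map_pow, map_ofNat]
    ring
  rw [hsq, hexp]
  simp only [coeff_add, coeff_C_mul_X_pow, coeff_C_mul_X, coeff_C, if_neg (show (6 : ℕ) ≠ 0 by norm_num)]
  norm_num

/-- At residue characteristic `3` with `|b₂| = 1` (height one), the `X⁶`-coefficient of `ΨSq₃` is a UNIT: `|b₂² + 18b₄| = 1`, for a
Weierstrass equation with integral coefficients. [cite: SilvermanAEC2009, III Ex. 3.7] -/
theorem val_coeff_six_ΨSq_three {V : WeierstrassCurve L} [hV : V.IsIntegral w.integer] (h3 : w (3 : L) < 1)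
    (hb₂ : w V.b₂ = 1) : w ((V.ΨSq 3).coeff 6) = 1 := by
  obtain ⟨M, hM⟩ := hV.integral
  have hb₄ : w V.b₄ ≤ 1 := by
    have : V.b₄ = algebraMap w.integer L M.b₄ := by rw [hM, baseChange, map_b₄]
    rw [this]; exact M.b₄.2
  rw [coeff_six_ΨSq_three]
  have hsmall : w (18 * V.b₄) < 1 := by
    have h18 : (18 : L) * V.b₄ = 3 * (6 * V.b₄) := by ring
    rw [h18, map_mul]
    have h6 : w ((6 : L) * V.b₄) ≤ 1 := by
      rw [map_mul]
      have h6L : (6 : L) = algebraMap w.integer L 6 := (map_ofNat (algebraMap w.integer L) 6).symm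
      have hw6 : w (6 : L) ≤ 1 := by rw [h6L]; exact (6 : w.integer).2
      calc w (6 : L) * w V.b₄ ≤ 1 * 1 := mul_le_mul' hw6 hb₄
        _ = 1 := one_mul 1
    calc w 3 * w (6 * V.b₄) ≤ w 3 * 1 := mul_le_mul' le_rfl h6
      _ = w 3 := mul_one _
      _ < 1 := h3
  have hsq : w (V.b₂ ^ 2) = 1 := by rw [map_pow, hb₂, one_pow]
  rw [w.map_add_eq_of_lt_left (by rw [hsq]; exact hsmall), hsq]

/-! ## §3 `E₁(L)` is `3`-divisible at height one -/

/-- **The kernel of reduction is `3`-divisible at residue characteristic `3`, height one** (`|b₂| = 1`): for `P = (x, y)` with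
`|x| > 1` there is `Q = (x', y')` with `|x'| > 1` and `3 • Q = P`.  Division polynomials: `F = Φ₃ − xΨSq₃` is monic of degree `9` with
`|F₆| = |x| > 1`, so it has a root `x'` with `|x'| > 1`; `ΨSq₃(x') ≠ 0` by `(Φ₃, ΨSq₃) = 1`; so `x(3Q) = Φ₃(x')/ΨSq₃(x') = x` and
`3Q = ±P` (AEC IV.3.2(b), VII.2.2, Ex. 3.7(d); for the Tate curve: `1 + 𝔪` is `3`-divisible).
[cite: SilvermanAEC2009, Prop. VII.2.2 and Exercise 3.7(d)] [cite: GreenbergLNM1716, §2 p. 82 («𝓕(𝔪̄) is divisible»)] -/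
theorem exists_zsmul_three_eq_of_one_lt_val [IsAlgClosed L] {V : WeierstrassCurve L} [hV : V.IsIntegral w.integer]
    [V.IsElliptic] (h3 : w (3 : L) < 1) (hb₂ : w V.b₂ = 1) {x y : L} (h : V.toAffine.Nonsingular x y) (hx : 1 < w x) :
    ∃ (x' y' : L) (h' : V.toAffine.Nonsingular x' y'), 1 < w x' ∧
      (3 : ℤ) • (Affine.Point.some x' y' h' : V.toAffine.Point) = Affine.Point.some x y h := by
  obtain ⟨M, hM⟩ := hV.integral
  -- the division polynomials of the integral model
  have hΦmap : V.Φ 3 = (M.Φ 3).map (algebraMap w.integer L) := by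
    rw [← map_Φ, hM, baseChange]
  have hΦint : ∀ i, w ((V.Φ 3).coeff i) ≤ 1 := fun i ↦ by
    rw [hΦmap, coeff_map]; exact ((M.Φ 3).coeff i).2
  have hΦtop : (V.Φ 3).coeff 9 = 1 := V.coeff_Φ 3
  have hΨdeg : (V.ΨSq 3).natDegree ≤ 8 := V.natDegree_ΨSq_le 3
  have hΨ9 : (V.ΨSq 3).coeff 9 = 0 := coeff_eq_zero_of_natDegree_lt (lt_of_le_of_lt hΨdeg (by norm_num))
  have hΦdeg : (V.Φ 3).natDegree ≤ 9 := V.natDegree_Φ_le 3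
  -- `F(X) = Φ₃(X) - x ΨSq₃(X)`, monic of degree `9`
  set F : L[X] := V.Φ 3 - C x * V.ΨSq 3 with hFdef
  have hFcoeff : ∀ i, F.coeff i = (V.Φ 3).coeff i - x * (V.ΨSq 3).coeff i := fun i ↦ by
    rw [hFdef, coeff_sub, coeff_C_mul]
  have hFdeg : F.natDegree ≤ 9 := by
    refine (natDegree_sub_le _ _).trans (max_le hΦdeg ?_)
    exact (natDegree_C_mul_le _ _).trans (hΨdeg.trans (by norm_num))
  have hF9 : F.coeff 9 = 1 := by rw [hFcoeff, hΦtop, hΨ9, mul_zero, sub_zero]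
  have hFnat : F.natDegree = 9 := by
    refine le_antisymm hFdeg (le_natDegree_of_ne_zero ?_)
    rw [hF9]; exact one_ne_zero
  have hFmonic : F.Monic := by
    rw [Monic, leadingCoeff, hFnat, hF9]
  -- `|F₆| = |x| > 1`
  have hF6 : 1 < w (F.coeff 6) := by
    rw [hFcoeff]
    have hbig : w (x * (V.ΨSq 3).coeff 6) = w x := by rw [map_mul, val_coeff_six_ΨSq_three h3 hb₂, mul_one]
    have hlt : w ((V.Φ 3).coeff 6) < w (x * (V.ΨSq 3).coeff 6) := by
      rw [hbig]; exact lt_of_le_of_lt (hΦint 6) hx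
    rw [w.map_sub_eq_of_lt_right hlt, hbig]
    exact hx
  -- a root `x'` with `|x'| > 1`
  obtain ⟨x', hroot, hx'⟩ := exists_root_one_lt_val_of_monic hFmonic (by rw [hFnat]; norm_num) hF6
  have hΦΨ : (V.Φ 3).eval x' = x * (V.ΨSq 3).eval x' := by
    have h0 := hroot.eq_zero
    rw [hFdef, eval_sub, eval_mul, eval_C, sub_eq_zero] at h0
    exact h0
  -- an ordinate `y'` over `x'` (`L` is algebraically closed) and the point `Q = (x', y')`
  obtain ⟨y', hy'⟩ : ∃ y', V.toAffine.Equation x' y' := by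
    obtain ⟨y', hy'⟩ := IsAlgClosed.exists_root
      (C 1 * X ^ 2 + C (V.a₁ * x' + V.a₃) * X + C (-(x' ^ 3 + V.a₂ * x' ^ 2 + V.a₄ * x' + V.a₆)))
      (by rw [degree_quadratic one_ne_zero]; exact two_ne_zero)
    refine ⟨y', (Affine.equation_iff ..).mpr ?_⟩
    have e : y' ^ 2 + (V.a₁ * x' + V.a₃) * y' - (x' ^ 3 + V.a₂ * x' ^ 2 + V.a₄ * x' + V.a₆) = 0 := by
      have := hy'
      simp only [IsRoot.def, eval_add, eval_mul, eval_C, eval_pow, eval_X, one_mul] at this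
      linear_combination this
    linear_combination e
  have hQ : V.toAffine.Nonsingular x' y' := Affine.equation_iff_nonsingular.mp hy'
  -- `ΨSq₃(x') ≠ 0` by coprimality
  have hΨne : (V.ΨSq 3).eval x' ≠ 0 := by
    intro h0
    have hΦ0 : (V.Φ 3).eval x' = 0 := by rw [hΦΨ, h0, mul_zero]
    exact V.eval_Φ_ne_zero_of_eval_ΨSq_eq_zero hQ h0 hΦ0
  -- `[3]Q` has `x`-coordinate `Φ₃(x')/ΨSq₃(x') = x`
  have hψ : (V.ψ 3).evalEval x' y' ≠ 0 := by
    intro h0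
    apply hΨne
    rw [← V.evalEval_ψ_sq hy' 3, h0, zero_pow two_ne_zero]
  obtain ⟨y₁, hns, hmQ⟩ := Affine.Point.zsmul_some_eq_some_φ_div hQ hψ
  have hx₁ : (V.φ 3).evalEval x' y' / (V.ψ 3).evalEval x' y' ^ 2 = x := by
    rw [V.evalEval_φ_eq_eval_Φ hy' 3, V.evalEval_ψ_sq hy' 3, hΦΨ, mul_div_cancel_right₀ _ hΨne]
  obtain ⟨hns', e'⟩ := UnivEC.some_eq_some_of_eq hx₁ rfl hns
  rw [e'] at hmQ
  -- so `[3]Q = ±P`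
  rcases (V.equation_iff_eq_or_eq_negY h.left y₁).mp hns'.left with hy₁ | hy₁
  · obtain ⟨h'', e''⟩ := UnivEC.some_eq_some_of_eq rfl hy₁ hns'
    refine ⟨x', y', hQ, hx', ?_⟩
    rw [hmQ, e'']
  · obtain ⟨h'', e''⟩ := UnivEC.some_eq_some_of_eq rfl hy₁ hns'
    refine ⟨x', V.toAffine.negY x' y', (Affine.nonsingular_neg ..).mpr hQ, hx', ?_⟩
    have e3 : (Affine.Point.some x' (V.toAffine.negY x' y') ((Affine.nonsingular_neg ..).mpr hQ) :
        V.toAffine.Point) = -Affine.Point.some x' y' hQ := by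
      rw [Affine.Point.neg_some]
    have e4 : (Affine.Point.some x (V.toAffine.negY x y) h'' : V.toAffine.Point) =
        -Affine.Point.some x y h := by
      rw [Affine.Point.neg_some]
    rw [e3, smul_neg, hmQ, e'', e4, neg_neg]

end Literature.NumberTheory.EllipticCurves

end
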